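import Literature.Geometry.Riemannian.HamiltonPICClassification
import Literature.Geometry.Riemannian.Necks
import Literature.Topology.FourManifolds.OrientedConnectedSumSphereSelf
import Literature.Topology.FourManifolds.NeckCapping
import Literature.Topology.FourManifolds.NeckStripCylinder
import HarnessLib

/-!
# Hamilton's surgery programme (simply connected case): the topological shadow of the Ricci flow
# with surgery, and the deduction of Thm. 1.1 / Cor. 1.2(a) from it

The topology underneath the named fact `Literature.Geometry.Riemannian.hamilton_pic_sphere_four`
(**Hamilton 1997, Cor. 1.2(a)**: a compact simply connected 4-manifold with positive isotropic
curvature is diffeomorphic to `S⁴`; `Literature/Geometry/Riemannian/PICSphereFacts.lean`), after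
`PICSphereFactsProofs.lean` (⇔ Thm. 1.1 in connected-sum-of-spheres form) and
`HamiltonPICClassification.lean` (⇔ Thm. 1.1 with the printed list of pieces). Hamilton's proof
of his Main Theorem 1.1 is the *surgically modified Ricci flow* (Comm. Anal. Geom. 5 (1997),
§1.1, pp. 3–4):

> "After flowing for a while, we recognize a neck, a region where the metric is very close to the
> product metric on `S³ × B¹` … we replace `S³ × B¹` with two copies of the ball `B⁴` by cutting the
> neck and rounding off the ends … Surgery may disconnect the manifold into a number of pieces. If
> one of these pieces is diffeomorphic to one of the standard models, we throw it away. … After a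
> finite number of surgeries in a finite time, and discarding a finite number of pieces, we are
> left with nothing. We can then recover the original manifold by starting with some collection of
> standard spaces and doing surgeries replacing two `B⁴`'s with an `S³ × B¹` …"

(made rigorous by Chen–Zhu, J. Differential Geom. 74 (2006), Thm. 1.1 — finitely many surgeries,
extinction in finite time — and §5, arXiv pp. 24–25 — the structure of the manifold at the
surgery times and its reconstruction by connected sums). This file separates, in the simply
connected case, the **topological shadow** of this programme from its analysis:

* `Literature.Geometry.Riemannian.IsNeckSurgeryResolvable M` — the inductive predicate "`M` is resolved by finitely many
  surgeries along separating necks into standard pieces": generated by (i) Hamilton's four model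
  pieces `S⁴`, `RP⁴`, `S³ × S¹`, `S³ ×~ S¹` (`Literature.Geometry.Riemannian.IsHamiltonPICPiece`, "we throw it away"), (ii)
  invariance under diffeomorphism, and (iii) *surgery*: if `ψ : S³ × ℝ ↪ M` is a neck whose middle
  sphere separates `M` into the two sides `D₁`, `D₂` (`Literature.Topology.FourManifolds.NeckCapData`, `NeckCapping.lean`) and
  both capped sides `Dᵢ.Capped` ("cutting the neck and rounding off the ends") are resolvable,
  then `M` is resolvable. Only separating necks are provided for, which is no loss when
  `π₁(M) = 1`: every neck of a simply connected manifold separates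
  (`Literature.Topology.FourManifolds.not_isPreconnected_compl_image_neck`, `NeckSeparation.lean`, Hirsch's Thm. 4.6), and the
  capped sides are again simply connected (below).
* `Literature.Geometry.Riemannian.IsNeckSurgeryResolvable.isConnectedSumOfSpheres` (**proved**): a simply connected
  resolvable `M` is a connected sum of copies of `S⁴` — induction over the surgery tree: a surgery
  along a separating neck writes `M ≅ D₁.Capped # D₂.Capped`
  (`Literature.Topology.FourManifolds.NeckCapData.isConnectedSum_capped`, via the tube criterion
  `Literature.Topology.FourManifolds.isConnectedSum_of_neck'` of `NeckConnectedSum.lean`, Kosinski VI §1), the summands of a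
  simply connected connected sum are simply connected (`ConnectedSumSummands.lean`, Kosinski VI
  Prop. 2.1), and the only simply connected model piece is `S⁴`
  (`IsHamiltonPICPiece.nonempty_diffeomorph_sphere_of_simplyConnectedSpace`); hence
  (`IsNeckSurgeryResolvable.nonempty_diffeomorph_sphere`, with Kervaire–Milnor's `S⁴ # S⁴ ≅ S⁴`,
  proved in `ConnectedSumSphereIdentity.lean`) **a simply connected resolvable `M` is
  diffeomorphic to `S⁴`**, and conversely (`isNeckSurgeryResolvable_iff_nonempty_diffeomorph_sphere`).
* **No separate named fact for the shadow** (D-0026). The statement "a closed simply connected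
  PIC 4-manifold is neck-surgery resolvable" — Hamilton 1997 §1.1 pp. 3–4 / Chen–Zhu 2006
  Thm. 1.1 with §5 in the simply connected case — was vended here earlier as a named fact
  `hamilton_pic_neckSurgery_resolvable_four`; by the previous bullet it is *equivalent*, manifold
  by manifold, to Cor. 1.2(a) itself, so as a decomposition node of `hamilton_pic_sphere_four` it
  carried no proof burden of its own and has been merged back into that fact. What the flow with
  surgery contributes is isolated instead in the named fact
  `Literature.Geometry.Riemannian.chenZhu_ricciFlowWithSurgery` (`SurgicalRicciFlow.lean`,
  Chen–Zhu's Thm. 1.1 as a structure theorem), from which — together with Cerf's `Γ₄ = 0` —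
  `SurgicalRicciFlowBridge.lean` PROVES that every closed simply connected PIC 4-manifold is
  neck-surgery resolvable (`isNeckSurgeryResolvable_of_chenZhu_of_cerf`) and hence Cor. 1.2(a)
  (`hamilton_pic_sphere_four_of_chenZhu_of_cerf`).
* `Literature.Geometry.Riemannian.LiesInEpsNeck.exists_neck`, `Literature.Geometry.Riemannian.IsCenterOfEpsNeck.exists_neck`
  (**the necks of the flow are necks for surgery**, proved): the neck chart of an `ε`-neck of a
  Riemannian manifold `(M, g)` (`Necks.lean`, Chen–Zhu 2006 §2 p. 4: a smooth open embedding of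
  the strip `Sᵐ × (-ε⁻¹, ε⁻¹)`) reparametrises (`NeckStripCylinder.lean`) to a neck
  `Sᵐ × ℝ ↪ M` in the sense of the `surgery` constructor, through `x`; hence
  (`exists_neckCapData_of_liesInEpsNeck`, `exists_isConnectedSum_of_liesInEpsNeck`) in a simply
  connected closed 4-manifold every `ε`-neck has the two sides required by `surgery`, and cutting
  it presents `M` as a connected sum of two simply connected closed manifolds — the form in which
  the surgery step of the flow invokes the constructor.

## References

* R. S. Hamilton, *Four-manifolds with positive isotropic curvature*, Comm. Anal. Geom. 5 (1997)
  1–92: Thm. 1.1 (p. 2), Cor. 1.2 (p. 3), §1.1 pp. 3–4 (the surgery programme), §4 (D: surgery),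
  §5 (E: the flow with surgery). [Hamilton1997]
* B.-L. Chen, X.-P. Zhu, *Ricci flow with surgery on four-manifolds with positive isotropic
  curvature*, J. Differential Geom. 74 (2006) 177–264 (arXiv:math/0504478): Thm. 1.1, Cor. 1.2
  (p. 3), §2 p. 4 (`ε`-necks), §5 (pp. 24–25). [ChenZhu2006]
* A. Kosinski, *Differential Manifolds* (1993), Ch. VI §§1–2, §9. [Kosinski1993]
* M. W. Hirsch, *Differential Topology* (1976), Ch. 4, Thm. 4.6. [Hirsch1976]
* M. Kervaire, J. Milnor, *Groups of homotopy spheres I*, Ann. of Math. 77 (1963), §2,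
  Lemma 2.1. [KervaireMilnor1963]

## Imports (refactor wi-07965)

`Necks.lean` no longer imports the connected-sum tower
(`Literature.Topology.FourManifolds.OrientedConnectedSumSphereSelf`). This file keeps that import
explicitly and TRANSITIONALLY, so that its own import closure and that of its importers
(`HamiltonSurgeryProgrammeProofs`, `…Glue`, `SurgicalRicciFlowBridge`, …) is unchanged by the
refactor; it is to be removed once every use of the tower below this file is imported where used.
-/

noncomputable section

open scoped Manifold ContDiff Topology
open Set Function

namespace Literature.Geometry.Riemannian

open Literature.Topology.FourManifolds

/-- Local notation: `𝔼 n` is the model Euclidean space `EuclideanSpace ℝ (Fin n)`. -/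
local notation "𝔼 " n:arg => EuclideanSpace ℝ (Fin n)

/-- Local notation: `𝕊 n` is the unit sphere in `EuclideanSpace ℝ (Fin (n + 1))`. -/
local notation "𝕊 " n:arg => (Metric.sphere (0 : EuclideanSpace ℝ (Fin (n + 1))) 1)

attribute [local instance] fact_finrank_euclideanSpace_succ

/-! ### Neck-surgery resolvability -/

/-- **Resolvability by surgeries along separating necks into Hamilton's model pieces** — the
topological shadow, for simply connected manifolds, of Hamilton's surgically modified Ricci flow
(Comm. Anal. Geom. 5 (1997), §1.1, pp. 3–4: "we replace `S³ × B¹` with two copies of the ball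
`B⁴` by cutting the neck and rounding off the ends … Surgery may disconnect the manifold into a
number of pieces. If one of these pieces is diffeomorphic to one of the standard models, we throw
it away … After a finite number of surgeries … and discarding a finite number of pieces, we are
left with nothing"). The smallest class of smooth 4-manifolds (types charted on `ℝ⁴`) which
(`piece`) contains every manifold that is one of the four model pieces `S⁴`, `RP⁴`, `S³ × S¹`,
`S³ ×~ S¹` (`IsHamiltonPICPiece`), (`of_diffeomorph`) is closed under diffeomorphism onto a `C^∞`
manifold, and (`surgery`) contains a Hausdorff `C^∞` manifold `M` as soon as it contains the two
capped sides `D₁.Capped`, `D₂.Capped` (`Literature.Topology.FourManifolds.NeckCapData.Capped`: the side with its end rounded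
off by a disc) of a neck `ψ : S³ × ℝ ↪ M` whose middle sphere `ψ (S³ × {0})` separates `M` into
the sides `D₁` (of `ψ`) and `D₂` (of the flipped neck `(θ, t) ↦ ψ (θ, -t)`). Metrics, times and
the simultaneity of surgeries are forgotten (disjoint necks may be cut one at a time: a neck
disjoint from `ψ` lies in one side and is a neck of its cap, `SmoothGlueData.isSmoothEmbedding_inl_comp`);
non-separating necks, which do not occur when `π₁ = 1` (`Literature.Topology.FourManifolds.not_isPreconnected_compl_image_neck`),
are not provided for. [cite: Hamilton1997, §1.1 pp. 3–4] -/
inductive IsNeckSurgeryResolvable : ∀ (M : Type) [TopologicalSpace M] [ChartedSpace (𝔼 4) M], Prop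
  /-- A model piece `S⁴`, `RP⁴`, `S³ × S¹`, `S³ ×~ S¹` is resolvable ("we throw it away"). -/
  | piece {M : Type} [TopologicalSpace M] [ChartedSpace (𝔼 4) M] (hM : IsHamiltonPICPiece M) :
      IsNeckSurgeryResolvable M
  /-- Resolvability is invariant under diffeomorphism onto a `C^∞` manifold. -/
  | of_diffeomorph {M M' : Type} [TopologicalSpace M] [ChartedSpace (𝔼 4) M]
      [TopologicalSpace M'] [ChartedSpace (𝔼 4) M'] [IsManifold (𝓡 4) ∞ M']
      (h : IsNeckSurgeryResolvable M) (e : M ≃ₘ⟮𝓡 4, 𝓡 4⟯ M') : IsNeckSurgeryResolvable M'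
  /-- Surgery along a separating neck: if both capped sides are resolvable, so is `M`. -/
  | surgery {M : Type} [TopologicalSpace M] [T2Space M] [ChartedSpace (𝔼 4) M]
      [IsManifold (𝓡 4) ∞ M] {ψ : 𝕊 3 × ℝ → M} (D₁ : NeckCapData 3 ψ)
      (D₂ : NeckCapData 3 (fun q : 𝕊 3 × ℝ => ψ (q.1, -q.2)))
      (hdisj : Disjoint (D₁.side : Set M) D₂.side)
      (hcover : ∀ p : M, p ∉ D₁.side → p ∉ D₂.side → ∃ θ : 𝕊 3, ψ (θ, 0) = p)
      (h₁ : IsNeckSurgeryResolvable D₁.Capped) (h₂ : IsNeckSurgeryResolvable D₂.Capped) :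
      IsNeckSurgeryResolvable M

/-- **A simply connected neck-surgery resolvable 4-manifold is a connected sum of copies of
`S⁴`.** Induction over the surgery tree: a simply connected model piece is `S⁴`
(`π₁(RP⁴) = ℤ₂`, `π₁(S³ × S¹) = π₁(S³ ×~ S¹) = ℤ`;
`IsHamiltonPICPiece.nonempty_diffeomorph_sphere_of_simplyConnectedSpace`); a surgery along a
separating neck writes `M` as the connected sum of the two capped sides
(`NeckCapData.isConnectedSum_capped`: Kosinski VI §1, "joining two manifolds by a tube";
Hamilton 1997, p. 4: "doing surgeries replacing two `B⁴`'s with an `S³ × B¹`" recovers the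
manifold), which are simply connected when `M` is (Kosinski VI §2, Prop. 2.1;
`IsConnectedSum.simplyConnectedSpace_left/right`), so the inductive hypotheses apply. This is the
topological half of Hamilton's deduction of Thm. 1.1 / Cor. 1.2(a) from the flow with surgery
(1997, pp. 3–4; Chen–Zhu 2006, arXiv p. 25). [cite: Hamilton1997, §1.1 pp. 3–4]
[cite: Kosinski1993, Ch. VI §1 (p. 90) and §2 Prop. 2.1 (p. 91)] -/
theorem IsNeckSurgeryResolvable.isConnectedSumOfSpheres {M : Type} [TopologicalSpace M]
    [ChartedSpace (𝔼 4) M] (h : IsNeckSurgeryResolvable M) (hsc : SimplyConnectedSpace M) :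
    IsConnectedSumOfSpheres 4 M := by
  induction h with
  | piece hM =>
    obtain ⟨e⟩ := hM.nonempty_diffeomorph_sphere_of_simplyConnectedSpace hsc
    exact .sphere e
  | of_diffeomorph h e ih =>
    have hsc' := (e.toHomeomorph.toHomotopyEquiv.simplyConnectedSpace_iff).2 hsc
    exact (ih hsc').of_diffeomorph e
  | surgery D₁ D₂ hdisj hcover h₁ h₂ ih₁ ih₂ =>
    haveI := hsc
    have hcs : IsConnectedSum (𝓡 4) (𝓡 4) (𝓡 4) D₁.Capped D₂.Capped _ :=
      D₁.isConnectedSum_capped D₂ (fun _ _ => rfl) hdisj hcover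
    have h2 : 1 < Module.finrank ℝ (𝔼 4) := by
      rw [finrank_euclideanSpace_fin]
      norm_num
    exact .connectedSum (ih₁ (hcs.simplyConnectedSpace_left h2))
      (ih₂ (hcs.simplyConnectedSpace_right h2)) hcs

/-- A manifold diffeomorphic to `S⁴` is resolvable (it is a model piece). [cite: Hamilton1997, §1.1 pp. 3–4] -/
theorem IsNeckSurgeryResolvable.of_nonempty_diffeomorph_sphere {M : Type} [TopologicalSpace M]
    [ChartedSpace (𝔼 4) M] (h : Nonempty (M ≃ₘ⟮𝓡 4, 𝓡 4⟯ 𝕊 4)) : IsNeckSurgeryResolvable M :=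
  .piece (IsHamiltonPICPiece.of_nonempty_diffeomorph_sphere h)

/-! ### Resolvable and simply connected ⇔ diffeomorphic to `S⁴` -/

/-- **A simply connected neck-surgery resolvable 4-manifold is diffeomorphic to `S⁴`** — the
topological half of Hamilton's deduction of Cor. 1.2(a) (p. 3) from the flow with surgery
(§1.1 pp. 3–4): by `IsNeckSurgeryResolvable.isConnectedSumOfSpheres` the manifold is a connected
sum of finitely many copies of `S⁴`, and a connected sum of `4`-spheres is a `4`-sphere
(`Literature.Topology.FourManifolds.IsConnectedSumOfSpheres.nonempty_diffeomorph_sphere`, from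
Kervaire–Milnor's `S⁴ # S⁴ ≅ S⁴`, `Literature.Topology.FourManifolds.connectedSum_sphere_sphere_holds`).
[cite: Hamilton1997, §1.1 pp. 3–4 and Cor. 1.2(a) (p. 3)] [cite: KervaireMilnor1963, §2, Lemma 2.1 (p. 505)] -/
theorem IsNeckSurgeryResolvable.nonempty_diffeomorph_sphere {M : Type} [TopologicalSpace M]
    [ChartedSpace (𝔼 4) M] [IsManifold (𝓡 4) ∞ M] (h : IsNeckSurgeryResolvable M)
    (hsc : SimplyConnectedSpace M) : Nonempty (M ≃ₘ⟮𝓡 4, 𝓡 4⟯ 𝕊 4) :=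
  (h.isConnectedSumOfSpheres hsc).nonempty_diffeomorph_sphere (by norm_num)
    (connectedSum_sphere_sphere_holds 4)

/-- **For a simply connected smooth 4-manifold, neck-surgery resolvability is equivalent to being
diffeomorphic to `S⁴`** (`IsNeckSurgeryResolvable.nonempty_diffeomorph_sphere`; conversely a
manifold diffeomorphic to `S⁴` is a model piece). This is why the shadow statement "every closed
simply connected PIC 4-manifold is neck-surgery resolvable" (Hamilton 1997, §1.1 pp. 3–4) is not
vended as a named fact of its own: manifold by manifold it is Cor. 1.2(a)
(`hamilton_pic_sphere_four`), and the flow-with-surgery input is the named fact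
`chenZhu_ricciFlowWithSurgery` (`SurgicalRicciFlow.lean`), see `SurgicalRicciFlowBridge.lean`.
[cite: Hamilton1997, §1.1 pp. 3–4 and Cor. 1.2(a) (p. 3)] -/
theorem isNeckSurgeryResolvable_iff_nonempty_diffeomorph_sphere {M : Type} [TopologicalSpace M]
    [ChartedSpace (𝔼 4) M] [IsManifold (𝓡 4) ∞ M] [hsc : SimplyConnectedSpace M] :
    IsNeckSurgeryResolvable M ↔ Nonempty (M ≃ₘ⟮𝓡 4, 𝓡 4⟯ 𝕊 4) :=
  ⟨fun h => h.nonempty_diffeomorph_sphere hsc, IsNeckSurgeryResolvable.of_nonempty_diffeomorph_sphere⟩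

/-! ### The necks of the flow are necks for surgery -/

section EpsNeck


variable {EM HM : Type*} [NormedAddCommGroup EM] [NormedSpace ℝ EM] [TopologicalSpace HM]
  {I : ModelWithCorners ℝ EM HM} {M : Type*} [TopologicalSpace M] [ChartedSpace HM M]
  [IsManifold I ∞ M] {m : ℕ}
  {g : Lorentzian.PseudoRiemannianMetric I ∞ EM (TangentSpace I : M → Type _)} {x : M} {ε r : ℝ}

/-- **A point lying in an `ε`-neck lies on a neck `Sᵐ × ℝ ↪ M`**: the neck chart
`Sᵐ × (-ε⁻¹, ε⁻¹) ↪ M` of the `ε`-neck (Chen–Zhu 2006, §2 p. 4; `Literature.Geometry.Riemannian.LiesInEpsNeck`,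
C⁰ form — only the chart is used, not the closeness of metrics) precomposed with the
diffeomorphism `Sᵐ × ℝ ≅ Sᵐ × (-ε⁻¹, ε⁻¹)` (`Literature.Topology.FourManifolds.cylinderStripDiffeomorph`,
`NeckStripCylinder.lean`) is a smooth embedding of the whole cylinder with the same (open)
range. [cite: ChenZhu2006, §2, p. 4]
-/
theorem LiesInEpsNeck.exists_neck (h : LiesInEpsNeck m g x ε r) :
    ∃ ψ : (𝕊 m) × ℝ → M, Manifold.IsSmoothEmbedding ((𝓡 m).prod 𝓘(ℝ, ℝ)) I ∞ ψ ∧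
      IsOpen (range ψ) ∧ x ∈ range ψ := by
  obtain ⟨φ, hφ, hopen, hx, -⟩ := h.exists_neckChart
  have hL : (0 : ℝ) < ε⁻¹ := inv_pos.2 h.pos.1
  refine ⟨φ ∘ cylinderStripDiffeomorph (𝓡 m) (𝕊 m) hL
      (neckStrip (EuclideanSpace ℝ (Fin (m + 1))) ε⁻¹) rfl,
    hφ.comp_cylinderStripDiffeomorph hL rfl, ?_, ?_⟩
  · rw [range_comp_cylinderStripDiffeomorph]
    exact hopen
  · rw [range_comp_cylinderStripDiffeomorph]
    exact hx

/-- **The centre of an `ε`-neck lies on the middle sphere of a neck `Sᵐ × ℝ ↪ M`** (same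
reparametrisation; the strip diffeomorphism preserves the central slice,
`Literature.Topology.FourManifolds.image_comp_cylinderStripDiffeomorph_slice`). [cite: ChenZhu2006, §2, p. 4] -/
theorem IsCenterOfEpsNeck.exists_neck (h : IsCenterOfEpsNeck m g x ε r) :
    ∃ ψ : (𝕊 m) × ℝ → M, Manifold.IsSmoothEmbedding ((𝓡 m).prod 𝓘(ℝ, ℝ)) I ∞ ψ ∧
      IsOpen (range ψ) ∧ ∃ θ : 𝕊 m, ψ (θ, 0) = x := by
  obtain ⟨φ, hφ, hopen, ⟨p, hp0, hpx⟩, -⟩ := h.exists_neckChart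
  have hL : (0 : ℝ) < ε⁻¹ := inv_pos.2 h.pos.1
  refine ⟨φ ∘ cylinderStripDiffeomorph (𝓡 m) (𝕊 m) hL
      (neckStrip (EuclideanSpace ℝ (Fin (m + 1))) ε⁻¹) rfl,
    hφ.comp_cylinderStripDiffeomorph hL rfl, ?_, (p : (𝕊 m) × ℝ).1, ?_⟩
  · rw [range_comp_cylinderStripDiffeomorph]
    exact hopen
  · -- the strip diffeomorphism fixes the central slice, so `(p.1, 0) ↦ p ↦ x`
    change φ (cylinderStripDiffeomorph (𝓡 m) (𝕊 m) hL
      (neckStrip (EuclideanSpace ℝ (Fin (m + 1))) ε⁻¹) rfl ((p : (𝕊 m) × ℝ).1, 0)) = x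
    rw [← cylinderStripDiffeomorph_symm_of_snd_eq_zero (IS := 𝓡 m) hL _ rfl hp0,
      Diffeomorph.apply_symm_apply]
    exact hpx

end EpsNeck

section EpsNeckFour


variable {M : Type*} [TopologicalSpace M] [T2Space M] [ChartedSpace (𝔼 4) M]
  [IsManifold (𝓡 4) ∞ M] [SimplyConnectedSpace M]
  {g : Lorentzian.PseudoRiemannianMetric (𝓡 4) ∞ (𝔼 4) (TangentSpace (𝓡 4) : M → Type _)} {x : M} {ε r : ℝ}

/-- **In a simply connected 4-manifold every `ε`-neck can be cut**: a point lying in an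
`ε`-neck of `(M, g)`, `M` Hausdorff and simply connected, lies on a neck `ψ : S³ × ℝ ↪ M` whose
middle sphere separates `M` into two sides `D₁`, `D₂` (`Literature.Topology.FourManifolds.exists_neckCapData_of_simplyConnected`:
Hirsch's Thm. 4.6 via `NeckSeparation.lean`) — exactly the data of the `surgery` constructor of
`IsNeckSurgeryResolvable`. [cite: Hamilton1997, §1.1 pp. 3–4] [cite: ChenZhu2006, §5 (arXiv p. 25)] -/
theorem exists_neckCapData_of_liesInEpsNeck (h : LiesInEpsNeck 3 g x ε r) :
    ∃ (ψ : (𝕊 3) × ℝ → M) (D₁ : NeckCapData 3 ψ)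
      (D₂ : NeckCapData 3 (fun q : (𝕊 3) × ℝ => ψ (q.1, -q.2))),
      x ∈ range ψ ∧ Disjoint (D₁.side : Set M) D₂.side ∧
      ∀ p : M, p ∉ D₁.side → p ∉ D₂.side → ∃ θ : 𝕊 3, ψ (θ, 0) = p := by
  obtain ⟨ψ, hψ, hopen, hx⟩ := h.exists_neck
  obtain ⟨D₁, D₂, hdisj, hcover⟩ := exists_neckCapData_of_simplyConnected (by norm_num) hψ hopen
  exact ⟨ψ, D₁, D₂, hx, hdisj, hcover⟩

/-- **Surgery along an `ε`-neck of a simply connected closed 4-manifold is a connected sum of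
two simply connected closed 4-manifolds** (the capped sides; `Literature.Topology.FourManifolds.exists_isConnectedSum_capped_of_simplyConnected`).
This is the topological step by which the flow with surgery establishes neck-surgery
resolvability inductively (`SurgicalRicciFlowBridge.lean`; Hamilton 1997, p. 4; Chen–Zhu 2006,
arXiv p. 25: "`M⁴` is diffeomorphic to a connected sum of the `Ω̄ⱼ` …").
[cite: Hamilton1997, §1.1 pp. 3–4] [cite: ChenZhu2006, §5 (arXiv p. 25)] -/
theorem exists_isConnectedSum_of_liesInEpsNeck [CompactSpace M] (h : LiesInEpsNeck 3 g x ε r) :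
    ∃ (ψ : (𝕊 3) × ℝ → M) (D₁ : NeckCapData 3 ψ)
      (D₂ : NeckCapData 3 (fun q : (𝕊 3) × ℝ => ψ (q.1, -q.2))),
      x ∈ range ψ ∧ IsConnectedSum (𝓡 4) (𝓡 4) (𝓡 4) D₁.Capped D₂.Capped M ∧
      SimplyConnectedSpace D₁.Capped ∧ SimplyConnectedSpace D₂.Capped ∧
      CompactSpace D₁.Capped ∧ CompactSpace D₂.Capped := by
  obtain ⟨ψ, hψ, hopen, hx⟩ := h.exists_neck
  obtain ⟨D₁, D₂, hcs, h₁, h₂⟩ := exists_isConnectedSum_capped_of_simplyConnected (by norm_num) hψ hopen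
  exact ⟨ψ, D₁, D₂, hx, hcs, h₁, h₂, inferInstance, inferInstance⟩

/-- **The surgery step of the programme along an `ε`-neck**: if the two capped sides of every
separating neck through the `ε`-neck region are resolvable, `M` is resolvable (the `surgery`
constructor applied to the neck of `exists_neckCapData_of_liesInEpsNeck`).
[cite: Hamilton1997, §1.1 pp. 3–4] -/
theorem IsNeckSurgeryResolvable.of_liesInEpsNeck {M : Type} [TopologicalSpace M] [T2Space M]
    [ChartedSpace (𝔼 4) M] [IsManifold (𝓡 4) ∞ M] [SimplyConnectedSpace M]
    {g : Lorentzian.PseudoRiemannianMetric (𝓡 4) ∞ (𝔼 4) (TangentSpace (𝓡 4) : M → Type _)} {x : M}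
    {ε r : ℝ} (h : LiesInEpsNeck 3 g x ε r)
    (hres : ∀ (ψ : (𝕊 3) × ℝ → M) (D₁ : NeckCapData 3 ψ)
      (D₂ : NeckCapData 3 (fun q : (𝕊 3) × ℝ => ψ (q.1, -q.2))), x ∈ range ψ →
      IsNeckSurgeryResolvable D₁.Capped ∧ IsNeckSurgeryResolvable D₂.Capped) :
    IsNeckSurgeryResolvable M := by
  obtain ⟨ψ, D₁, D₂, hx, hdisj, hcover⟩ := exists_neckCapData_of_liesInEpsNeck h
  obtain ⟨h₁, h₂⟩ := hres ψ D₁ D₂ hx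
  exact .surgery D₁ D₂ hdisj hcover h₁ h₂

end EpsNeckFour

end Literature.Geometry.Riemannian

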